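import Literature.Barriers.CriticalPhenomena.LaceExpansionGaussianDeconvolutionLem29
import Literature.Barriers.CriticalPhenomena.LaceExpansionIsingDeconvolutionPartsInfrared
import Literature.Barriers.CriticalPhenomena.LaceExpansionIsingDeconvolutionFourier
import HarnessLib

/-!
# Liu–Slade 2026, Theorem 2.2: the objects of §3.1 and "Proof of Theorem 2.2 assuming
# Proposition 3.2"

Barrier catalogue `Literature/Barriers/CriticalPhenomena/` (D-0021), proofs companion of
`LaceExpansionIsingDeconvolutionParts.lean`, which vendors Liu–Slade 2026, Theorem 2.2 (Gaussian
deconvolution for spread-out models) as the named fact `LiuSlade2026_thm22`. This file formalizes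
the top layer of its printed proof (Liu–Slade 2026, §3.1):

* the objects of §3.1: `soA d L μ = A_μ = δ - μD` (so that `A_μ * S_μ = δ`) and the Fourier-side
  error term `lsfHat d L z Π = f̂_z = 1/F̂_z - λ_z/Â_{μ_z}` of (3.5);
* `fourierInverseG_soA` — `S_μ(x) = ∫_{𝕋^d} e^{-ik·x}/Â_μ(k) dk/(2π)^d` for `μ ∈ [0,1]`, `d ≥ 3`
  (the identification of the series `Σ_n μⁿD^{*n}` with the Fourier integral (1.7), through the
  tree's `soGreen_eq_integral` and the bridge `fourierInverseG_eq_re_haraH`);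
* `integrable_inv_of_infrared` — "In dimensions `d > 2`, the infrared bound implies absolute
  convergence of the Fourier integral (2.1)": `1/ĝ ∈ L¹(𝕋^d)` whenever
  `Re ĝ(k) ≥ K(|k|² ∧ 1)` (fundamental domain `(-1/2,1/2]^d`, `∫_{|y|<1} |y|^{-2} dy < ∞`);
* `norm_mFourierCoeff_le_of_weakDeriv_of_ne_zero` — the `x ≠ 0` refinement of Lemma 3.1
  (= Liu–Slade 2024, Lemma 2.3, the tree's `LiuSlade2024_lem23`): "the `|α| = 0` part of (3.7) is
  only used to estimate `h(0)`", i.e. `|x|ⁿ|h(x)| ≤ d^{n/2} max_{|α|=n} ‖ĥ_α‖₁`;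
* `LiuSlade2026_thm22_of_prop32` — **the source's "Proof of Theorem 2.2 assuming
  Proposition 3.2"**: from Proposition 3.2 (stated as an explicit hypothesis over `lsfHat` and
  the weak derivatives `HasTorusWeakDeriv` of Liu–Slade 2024, Definition A.1, in its `r = 1`
  case, which is the case the printed proof uses: `f̂_z` is `n_d` times weakly differentiable,
  `‖f̂_z‖₁ ≲ β`, `‖f̂_α‖₁ ≲ β(L^{-c} + β) + β₁` for `|α| = n_d`), the infrared bound (2.3)
  (`LiuSlade2026_infraredBound_holds`), (2.5)–(2.6) (`exists_lsLambda_estimates`: `λ_z ∈ (0,2]`,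
  `μ_z ∈ [0,1]`) and Lemma 3.1, conclude (2.8) with its `o(|x|^{-n_d})` clause and the absolute
  convergence of (2.1).

Proposition 3.2 itself (§3.2–3.3 of the source: Lemma 3.3 via Hölder's inequality, the
Hausdorff–Young bounds of Liu–Slade 2024, Lemma 2.6, the moment bounds of Lemma 2.2, the
spread-out estimates of Lemma 3.6/App. B, and the product and quotient rules for weak derivatives
of Liu–Slade 2024, App. A) is NOT proved here and is NOT vendored as a named fact (D-0026): it is
the remaining obligation of `LiuSlade2026_thm22_holds`.

## References

* Y. Liu, G. Slade, *Gaussian deconvolution and the lace expansion for spread-out models*,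
  Ann. Inst. H. Poincaré Probab. Statist. 62 (2026), arXiv:2310.07640: (1.7), (2.1), (2.3)–(2.8),
  Theorem 2.2; §3.1: (3.2)–(3.5), Lemma 3.1 with (3.7), (3.6), Proposition 3.2 with (3.8)–(3.9),
  "Proof of Theorem 2.2 assuming Proposition 3.2" [LiuSlade2026]. Equation numbers are those of
  the arXiv version held in the literature store.
* Y. Liu, G. Slade, *Gaussian deconvolution and the lace expansion*, Probab. Theory Related
  Fields 195 (2024), arXiv:2310.07635: Lemma 2.3, Appendix A, Definition A.1 [LiuSlade2024].
-/

noncomputable section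

namespace Literature.Barriers.CriticalPhenomena.SpreadOutIsing

open Filter UnitAddTorus Literature.Probability.LatticeModels
open Literature.Analysis.FunctionSpaces
open _root_.MeasureTheory _root_.Topology
open scoped ENNReal

variable {d L : ℕ}

/-! ## Part 1. The objects `A_μ` and `f̂_z` of §3.1 -/

/-- `A_μ = δ - μD` for the spread-out step distribution `D = soStep d L` ("For `μ ∈ (0,1]`, define
`A_μ = δ - μD`, so that `A_μ * S_μ = δ` by (1.7)"). [cite: LiuSlade2026, §3.1 (definition of A_μ preceding (3.2))] -/
def soA (d L : ℕ) (μ : ℝ) (x : Site d) : ℝ := delta0 x - μ * soStep d L x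

/-- The Fourier-side error term `f̂_z = 1/F̂_z - λ_z/Â_{μ_z}` of (3.5) (`= Ê_{z,λ_z,μ_z}/(Â_{μ_z}F̂_z)`,
the transform of `f_z = 𝒢_z - λ_z S_{μ_z} = S_{μ_z} * E_{z,λ_z,μ_z} * 𝒢_z` of (3.4)), for
`F_z = lsF d L z Π` with the constants `λ_z, μ_z` of (2.4), as a function on the unit torus
(coordinate `k = 2πt` of `latticeFourier`). [cite: LiuSlade2026, (3.4)–(3.5)] -/
def lsfHat (d L : ℕ) (z : ℝ) (Pz : Site d → ℝ) (t : UnitAddTorus (Fin d)) : ℂ :=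
  (latticeFourier (lsF d L z Pz) t)⁻¹ -
    (lsLambda d L (lsF d L z Pz) : ℂ) *
      (latticeFourier (soA d L (lsMu d L (lsF d L z Pz))) t)⁻¹

/-- `A_μ` is `F_z` of Assumption 2.1 with `z = μ` and `Π ≡ 0`. [cite: LiuSlade2026, §3.1 and Assumption 2.1] -/
theorem soA_eq_lsF (μ : ℝ) : soA d L μ = lsF d L μ (fun _ => 0) := by
  funext x; simp [soA, lsF]

/-- `A_μ` is absolutely summable (`δ` and `D` are finitely supported). [folklore] -/
theorem summable_abs_soA (μ : ℝ) : Summable fun x => |soA d L μ x| :=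
  (summable_abs_delta0.of_abs.sub (summable_abs_soStep.of_abs.mul_left μ)).abs

/-- `Â_μ = 1 - μD̂` on the torus. [cite: LiuSlade2026, Lemma 3.6 ("Â_μ = 1 - μD̂")] -/
theorem latticeFourier_soA (μ : ℝ) (t : UnitAddTorus (Fin d)) :
    latticeFourier (soA d L μ) t = 1 - (μ : ℂ) * latticeFourier (soStep d L) t := by
  unfold latticeFourier
  have h1 : Summable fun x : Site d => ((delta0 x : ℝ) : ℂ) * mFourier x t :=
    summable_latticeFourier_term summable_abs_delta0 t
  have h2 : Summable fun x : Site d => ((soStep d L x : ℝ) : ℂ) * mFourier x t :=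
    summable_latticeFourier_term summable_abs_soStep t
  have h3 : ∀ x : Site d, ((soA d L μ x : ℝ) : ℂ) * mFourier x t =
      ((delta0 x : ℝ) : ℂ) * mFourier x t - (μ : ℂ) * (((soStep d L x : ℝ) : ℂ) * mFourier x t) := by
    intro x
    simp only [soA]
    push_cast
    ring
  simp_rw [h3]
  rw [Summable.tsum_sub h1 (h2.mul_left _), tsum_mul_left]
  congr 1
  have := latticeFourier_delta0 (d := d) t
  unfold latticeFourier at this
  exact this

/-- `|D̂(t)| ≤ 1` on the torus (`Σ_x D(x) = 1`, `d, L ≥ 1`). [folklore] -/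
theorem norm_latticeFourier_soStep_le (hd : 1 ≤ d) (hL : 1 ≤ L) (t : UnitAddTorus (Fin d)) :
    ‖latticeFourier (soStep d L) t‖ ≤ 1 := by
  refine (norm_latticeFourier_le summable_abs_soStep t).trans_eq ?_
  have h : (fun x => |soStep d L x|) = soStep d L := funext fun x => abs_of_nonneg (soStep_nonneg x)
  rw [h, (hasSum_soStep hd hL).tsum_eq]

/-- `Re Â_μ(t) ≥ (1/2) Re Â_1(t)` for `μ ∈ [0,1]`: `1 - μ Re D̂ ≥ 1 - Re D̂` where `Re D̂ ≥ 0`, and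
`1 - μ Re D̂ ≥ 1 ≥ (1 - Re D̂)/2` where `-1 ≤ Re D̂ < 0`. [folklore] -/
theorem re_latticeFourier_soA_ge (hd : 1 ≤ d) (hL : 1 ≤ L) {μ : ℝ} (hμ0 : 0 ≤ μ) (hμ1 : μ ≤ 1)
    (t : UnitAddTorus (Fin d)) :
    (1 - (latticeFourier (soStep d L) t).re) / 2 ≤ (latticeFourier (soA d L μ) t).re := by
  rw [latticeFourier_soA, Complex.sub_re, Complex.one_re, Complex.re_ofReal_mul]
  have hD : |(latticeFourier (soStep d L) t).re| ≤ 1 :=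
    (Complex.abs_re_le_norm _).trans (norm_latticeFourier_soStep_le hd hL t)
  have hD1 := (abs_le.1 hD).1
  have hD2 := (abs_le.1 hD).2
  rcases le_or_gt 0 (latticeFourier (soStep d L) t).re with h | h
  · nlinarith [mul_le_mul_of_nonneg_right hμ1 h]
  · nlinarith

/-! ## Part 2. `S_μ` is the Fourier integral `∫ e^{-ik·x}/Â_μ` -/

/-- `1/(1 - μD̂)` is integrable on the Brillouin zone for `d ≥ 3`, `L ≥ 1`, `μ ∈ [0,1]`
(majorant `1 + 1/(1 - D̂)`, the tree's `integrableOn_inv_one_sub_soSymbol`). [cite: LiuSlade2026, §1.2.1, (1.7) (S_μ as an absolutely convergent Fourier integral, d > 2)] -/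
theorem integrableOn_inv_one_sub_mul_soSymbol (hd : 3 ≤ d) (hL : 1 ≤ L) {μ : ℝ} (hμ0 : 0 ≤ μ)
    (hμ1 : μ ≤ 1) : IntegrableOn (fun k => (1 - μ * soSymbol d L k)⁻¹) (cube d) volume := by
  have hd1 : 1 ≤ d := by omega
  have hd2 : 2 ≤ d := by omega
  have hmaj : IntegrableOn (fun k : Fin d → ℝ => 1 + 1 / (1 - soSymbol d L k)) (cube d) volume :=
    (integrableOn_const (hs := (isCompact_univ_pi fun _ => isCompact_Icc).measure_lt_top.ne)).add
      (integrableOn_inv_one_sub_soSymbol hd hL)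
  have hmeas : AEStronglyMeasurable (fun k => (1 - μ * soSymbol d L k)⁻¹) (volume.restrict (cube d)) :=
    (measurable_const.sub (measurable_const.mul continuous_soSymbol.measurable)).inv.aestronglyMeasurable
  refine Integrable.mono' hmaj hmeas ?_
  filter_upwards [ae_ne_zero_restrict_cube hd1, self_mem_ae_restrict (measurableSet_cube d)]
    with k hk0 hk
  have hlt := soSymbol_lt_one hd1 hL hk hk0
  have ht := abs_mul_soSymbol_lt_one hd2 hL hμ0 hμ1 hk hk0
  have ht1 : μ * soSymbol d L k < 1 := (abs_lt.1 ht).2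
  have h1s : 0 < 1 - soSymbol d L k := by linarith
  rw [Real.norm_eq_abs, abs_of_pos (inv_pos.2 (by linarith)), ← one_div]
  rcases le_or_gt 0 (soSymbol d L k) with hs | hs
  · have hle : 1 - soSymbol d L k ≤ 1 - μ * soSymbol d L k := by
      nlinarith [mul_le_mul_of_nonneg_right hμ1 hs]
    have := one_div_le_one_div_of_le h1s hle
    have h0 : (0 : ℝ) ≤ 1 := zero_le_one
    linarith
  · have hle : (1 : ℝ) ≤ 1 - μ * soSymbol d L k := by nlinarith
    have := one_div_le_one_div_of_le one_pos hle
    rw [div_one] at this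
    have h0 : 0 ≤ 1 / (1 - soSymbol d L k) := by positivity
    linarith

/-- The cube-side transform of `μD` is real: `1 - (μD)^(k) = 1 - μ Re D̂(k)` with
`Re D̂ = soSymbol`. [folklore] -/
theorem one_sub_latticeFT_mul_soStep (μ : ℝ) (k : Fin d → ℝ) :
    1 - latticeFT (fun y => μ * soStep d L y) k = ((1 - μ * soSymbol d L k : ℝ) : ℂ) := by
  have hsum : Summable fun y : Site d => |μ * soStep d L y| := (summable_abs_soStep.of_abs.mul_left μ).abs
  have heven : ∀ y : Site d, μ * soStep d L (-y) = μ * soStep d L y := fun y => by rw [soStep_neg]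
  rw [one_sub_latticeFT_eq_ofReal hsum heven]
  congr 2
  -- `Re (μD)^ = μ Re D̂ = μ soSymbol`
  have hlin : latticeFT (fun y => μ * soStep d L y) k = (μ : ℂ) * latticeFT (soStep d L) k := by
    unfold latticeFT
    rw [← tsum_mul_left]
    refine tsum_congr fun y => ?_
    push_cast
    ring
  rw [hlin, Complex.re_ofReal_mul, soSymbol_eq_re_latticeFT]

/-- **`S_μ = ∫ e^{-ik·x}/Â_μ`**: for `d ≥ 3`, `L ≥ 1`, `μ ∈ [0,1]` the series `S_μ = Σ_n μⁿD^{*n}`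
(`soGreen`) is the Fourier integral (2.1) of `F = A_μ` (`fourierInverseG (soA d L μ)`), i.e. the
source's definition (1.7) of `S_μ`. Proof: the torus-side integral is Hara's `H(x)` with `J = μD`,
`g = δ₀` (`fourierInverseG_eq_re_haraH`), whose integrand has real part `cos(k·x)/(1 - μD̂(k))`, and
the cube-side identity is the tree's `soGreen_eq_integral`.
[cite: LiuSlade2026, (1.7) and (2.1)] -/
theorem fourierInverseG_soA (hd : 3 ≤ d) (hL : 1 ≤ L) {μ : ℝ} (hμ0 : 0 ≤ μ) (hμ1 : μ ≤ 1)
    (x : Site d) : fourierInverseG (soA d L μ) x = soGreen d L μ x := by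
  have hd1 : 1 ≤ d := by omega
  rw [fourierInverseG_eq_re_haraH (summable_abs_soA μ) x, soGreen_eq_integral hd hL hμ0 hμ1 x]
  have hJ : (fun y : Site d => delta0 y - soA d L μ y) = fun y => μ * soStep d L y := by
    funext y; simp [soA]
  rw [hJ, haraH]
  -- the integrand
  have hI : ∀ k, haraIntegrand (fun y => μ * soStep d L y) delta0 x k =
      Complex.exp (Complex.I * (kdot k x : ℂ)) * (((1 - μ * soSymbol d L k)⁻¹ : ℝ) : ℂ) := by
    intro k
    unfold haraIntegrand
    rw [latticeFT_delta0, one_sub_latticeFT_mul_soStep, one_div, Complex.ofReal_inv]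
  have hint : IntegrableOn (fun k => haraIntegrand (fun y => μ * soStep d L y) delta0 x k) (cube d) := by
    simp_rw [hI]
    refine Integrable.bdd_mul (c := 1) (integrableOn_inv_one_sub_mul_soSymbol hd hL hμ0 hμ1).ofReal
      ?_ (ae_of_all _ fun k => ?_)
    · exact (Complex.continuous_exp.comp (continuous_const.mul
        (Complex.continuous_ofReal.comp (continuous_kdot_left x)))).aestronglyMeasurable
    · rw [Complex.norm_exp]
      simp
  have h2π : ((2 * Real.pi : ℂ)) ^ d = (((2 * Real.pi) ^ d : ℝ) : ℂ) := by push_cast; ring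
  rw [h2π, Complex.div_ofReal_re]
  have hre : (∫ k in cube d, haraIntegrand (fun y => μ * soStep d L y) delta0 x k).re =
      ∫ k in cube d, Real.cos (kdot k x) / (1 - μ * soSymbol d L k) := by
    rw [← RCLike.re_to_complex, ← integral_re hint]
    refine integral_congr_ae (ae_of_all _ fun k => ?_)
    simp only [RCLike.re_to_complex]
    rw [hI, Complex.re_mul_ofReal, mul_comm Complex.I, Complex.exp_ofReal_mul_I_re, div_eq_mul_inv]
  rw [hre, div_eq_inv_mul]

/-! ## Part 3. Absolute convergence of the Fourier integral (2.1) from an infrared bound -/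

/-- **"In dimensions `d > 2`, the infrared bound implies absolute convergence of the Fourier
integral (2.1)"**: if `ĝ` is continuous on `𝕋^d`, `d ≥ 3`, and `Re ĝ(t) ≥ K (Σᵢ‖tᵢ‖² ∧ 1)` with
`K > 0` (the infrared bound (2.3) in the coordinate `k = 2πt`, after `F̂_z(0) ≥ 0`), then
`1/ĝ ∈ L¹(𝕋^d)`. Proof: on the fundamental domain `(-1/2,1/2]^d` (Mathlib's
`UnitAddTorus.lintegral_preimage`, transported along `Torus.volume_eq_pi_haarAddCircle`) the
quotient norms are `‖tᵢ‖ = |yᵢ|`, so `|1/ĝ| ≤ K⁻¹‖y‖_∞^{-2}`, integrable near `0` for `d ≥ 3`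
(`integrableOn_norm_rpow_neg_two_ball`). [cite: LiuSlade2026, §2.1 (sentence following (2.3))] -/
theorem integrable_inv_of_infrared (hd : 3 ≤ d) {g : UnitAddTorus (Fin d) → ℂ} (hg : Continuous g)
    {K : ℝ} (hK : 0 < K) (hlow : ∀ t, K * min (∑ i, ‖t i‖ ^ 2) 1 ≤ (g t).re) :
    Integrable fun t => (g t)⁻¹ := by
  refine ⟨hg.measurable.inv.aestronglyMeasurable, ?_⟩
  -- pass to the fundamental domain
  set box : Set (Fin d → ℝ) := {v | ∀ i, v i ∈ Set.Ioc (-(1 / 2 : ℝ)) (-(1 / 2 : ℝ) + 1)} with hbox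
  have htrans : ∫⁻ t, ‖(g t)⁻¹‖ₑ = ∫⁻ v in box, ‖(g fun i => ((v i : ℝ) : UnitAddCircle))⁻¹‖ₑ :=
    (congrArg (fun ν : Measure (UnitAddTorus (Fin d)) => ∫⁻ t, ‖(g t)⁻¹‖ₑ ∂ν)
      (Torus.volume_eq_pi_haarAddCircle (d := Fin d))).trans
      (UnitAddTorus.lintegral_preimage (fun t => ‖(g t)⁻¹‖ₑ) fun _ => -(1 / 2 : ℝ))
  unfold HasFiniteIntegral
  rw [htrans]
  -- the majorant `K⁻¹ ‖v‖^{-2}` on the box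
  have hboxm : MeasurableSet box := by
    have : box = Set.pi Set.univ fun _ => Set.Ioc (-(1 / 2 : ℝ)) (-(1 / 2 : ℝ) + 1) := by
      ext v; simp [hbox]
    rw [this]
    exact MeasurableSet.univ_pi fun _ => measurableSet_Ioc
  have hsub : box ⊆ Metric.ball (0 : Fin d → ℝ) 1 := by
    intro v hv
    rw [Metric.mem_ball, dist_zero_right]
    refine lt_of_le_of_lt ((pi_norm_le_iff_of_nonneg (by norm_num : (0 : ℝ) ≤ 1 / 2)).2 fun i => ?_)
      (by norm_num)
    rw [Real.norm_eq_abs, abs_le]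
    have := hv i
    constructor <;> linarith [this.1, this.2]
  have hmaj : IntegrableOn (fun v : Fin d → ℝ => K⁻¹ * ‖v‖ ^ (-2 : ℝ)) box volume :=
    ((integrableOn_norm_rpow_neg_two_ball hd 1).mono_set hsub).const_mul _
  refine lt_of_le_of_lt (lintegral_mono_ae ?_) hmaj.2
  haveI : Nonempty (Fin d) := ⟨⟨0, by omega⟩⟩
  have hne : ∀ᵐ v ∂(volume.restrict box), v ≠ (0 : Fin d → ℝ) := by
    have h0 : (volume.restrict box) {(0 : Fin d → ℝ)} = 0 :=
      le_antisymm ((Measure.restrict_apply_le _ _).trans (measure_singleton _).le) bot_le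
    filter_upwards [measure_eq_zero_iff_ae_notMem.1 h0] with v hv
    simpa using hv
  filter_upwards [hne, ae_restrict_mem hboxm] with v hv0 hv
  -- at a point `v ≠ 0` of the box
  have habs : ∀ i, |v i| ≤ 1 / 2 := fun i => by
    have := hv i
    rw [abs_le]; constructor <;> linarith [this.1, this.2]
  have hnorm : ∀ i, ‖((v i : ℝ) : UnitAddCircle)‖ = |v i| := fun i => by
    rw [(AddCircle.norm_coe_eq_abs_iff (p := (1 : ℝ)) one_ne_zero).2]
    simpa using habs i
  have hsum : ∑ i, ‖((v i : ℝ) : UnitAddCircle)‖ ^ 2 = ∑ i, v i ^ 2 :=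
    Finset.sum_congr rfl fun i _ => by rw [hnorm i, sq_abs]
  have hvn : 0 < ‖v‖ := norm_pos_iff.2 hv0
  have hvn2 : ‖v‖ ≤ 1 / 2 := (pi_norm_le_iff_of_nonneg (by norm_num)).2 fun i => by
    rw [Real.norm_eq_abs]; exact habs i
  have hmin : ‖v‖ ^ 2 ≤ min (∑ i, v i ^ 2) 1 := by
    refine le_min (norm_sq_le_sum_sq v) ?_
    nlinarith
  have hre := hlow (fun i => ((v i : ℝ) : UnitAddCircle))
  rw [hsum] at hre
  have hKv : 0 < K * ‖v‖ ^ 2 := by positivity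
  have hle : K * ‖v‖ ^ 2 ≤ ‖g fun i => ((v i : ℝ) : UnitAddCircle)‖ :=
    ((mul_le_mul_of_nonneg_left hmin hK.le).trans hre).trans (Complex.re_le_norm _)
  have hG : ‖K⁻¹ * ‖v‖ ^ (-2 : ℝ)‖ = (K * ‖v‖ ^ 2)⁻¹ := by
    rw [Real.rpow_neg (norm_nonneg v), Real.rpow_two, ← mul_inv, Real.norm_eq_abs,
      abs_of_pos (inv_pos.2 hKv)]
  rw [enorm_eq_nnnorm, enorm_eq_nnnorm, ENNReal.coe_le_coe, ← NNReal.coe_le_coe, coe_nnnorm,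
    coe_nnnorm, hG, norm_inv]
  exact inv_anti₀ hKv hle

/-! ## Part 4. Lemma 3.1 in the pure directions `α = (j,…,j)` -/

/-- **The key step of Lemma 3.1 in a pure direction**: if `ĥ` has integrable weak derivatives
`ĥ_{(j,…,j)}` of order `n` in every coordinate direction `j` (Liu–Slade 2024, Definition A.1), then
for `x ≠ 0`, with `j` the direction maximising `|xⱼ|` (so `|x| ≤ √d|xⱼ|`, `|x| ≥ 1`),
`|x|ⁿ|h(x)| ≤ d^{n/2}|𝓕ĥ_{(j,…,j)}(x)|` (`h = 𝓕ĥ`; integration by parts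
`(2πi xⱼ)ⁿ𝓕ĥ(x) = 𝓕ĥ_{(j,…,j)}(x)`). Only the pure multi-indices `(j,…,j)` enter, as in the
printed proof. [cite: LiuSlade2026, Lemma 3.1 with (3.7)] [cite: LiuSlade2024, Lemma 2.3 and its proof] -/
theorem pow_mul_norm_mFourierCoeff_le_of_weakDeriv (n : ℕ) {hh : UnitAddTorus (Fin d) → ℂ}
    {w : Fin d → UnitAddTorus (Fin d) → ℂ}
    (hweak : ∀ j : Fin d, HasTorusWeakDeriv hh (List.replicate n j) (w j)) {x : Site d} (hx : x ≠ 0) :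
    ∃ j : Fin d, 1 ≤ euclidNorm x ∧
      euclidNorm x ^ n * ‖mFourierCoeff hh x‖ ≤ Real.sqrt d ^ n * ‖mFourierCoeff (w j) x‖ := by
  -- the direction `j` maximising `|x_j|`
  obtain ⟨i₀, hi₀⟩ : ∃ i, x i ≠ 0 := by
    by_contra h
    push Not at h
    exact hx (funext h)
  obtain ⟨j, -, hj⟩ := Finset.exists_max_image Finset.univ (fun i => |x i|) ⟨i₀, Finset.mem_univ _⟩
  have hxj : x j ≠ 0 := by
    intro h0
    have := hj i₀ (Finset.mem_univ i₀)
    rw [h0, abs_zero] at this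
    exact hi₀ (abs_nonpos_iff.1 this)
  set m : ℝ := |(x j : ℝ)| with hm
  have hm1 : 1 ≤ m := by
    rw [hm, ← Int.cast_abs]
    exact_mod_cast Int.one_le_abs hxj
  have hm0 : 0 < m := by linarith
  have hji : ∀ i, |(x i : ℝ)| ≤ m := fun i => by
    rw [hm, ← Int.cast_abs, ← Int.cast_abs]
    exact_mod_cast hj i (Finset.mem_univ i)
  have hcoef := mFourierCoeff_weakDeriv_replicate (hweak j) x
  have hstep1 : m ^ n * ‖mFourierCoeff hh x‖ ≤ ‖mFourierCoeff (w j) x‖ := by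
    rw [hcoef, norm_mul, norm_pow]
    have hnorm : ‖(2 * Real.pi * Complex.I * (x j : ℂ))‖ = 2 * Real.pi * m := by
      rw [norm_mul, norm_mul, norm_mul, Complex.norm_I, mul_one, Complex.norm_intCast,
        Complex.norm_real, Real.norm_eq_abs, abs_of_pos Real.pi_pos, Complex.norm_two]
    rw [hnorm]
    gcongr
    calc m = 1 * m := (one_mul m).symm
      _ ≤ 2 * Real.pi * m := by gcongr; linarith [Real.pi_gt_three]
  have hE : euclidNorm x ≤ Real.sqrt d * m := euclidNorm_le_sqrt_mul hm0.le hji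
  have hE1 : 1 ≤ euclidNorm x := hm1.trans (abs_apply_le_euclidNorm x j)
  have hE0 : 0 < euclidNorm x := by linarith
  refine ⟨j, hE1, ?_⟩
  calc euclidNorm x ^ n * ‖mFourierCoeff hh x‖ ≤ (Real.sqrt d * m) ^ n * ‖mFourierCoeff hh x‖ :=
        mul_le_mul_of_nonneg_right (pow_le_pow_left₀ hE0.le hE n) (norm_nonneg _)
    _ = Real.sqrt d ^ n * (m ^ n * ‖mFourierCoeff hh x‖) := by rw [mul_pow]; ring
    _ ≤ Real.sqrt d ^ n * ‖mFourierCoeff (w j) x‖ := mul_le_mul_of_nonneg_left hstep1 (by positivity)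

/-- Lemma 3.1 off the origin, quantitative form: with `‖ĥ_{(j,…,j)}‖₁ ≤ M` for all `j`,
`|h(x)| ≤ d^{n/2} M/|x|ⁿ` for `x ≠ 0`. [cite: LiuSlade2026, Lemma 3.1 with (3.7)] [cite: LiuSlade2024, Lemma 2.3] -/
theorem norm_mFourierCoeff_le_of_weakDeriv_of_ne_zero (n : ℕ) {hh : UnitAddTorus (Fin d) → ℂ}
    {w : Fin d → UnitAddTorus (Fin d) → ℂ} {M : ℝ}
    (hweak : ∀ j : Fin d, HasTorusWeakDeriv hh (List.replicate n j) (w j))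
    (hM : ∀ j : Fin d, (∫ t, ‖w j t‖) ≤ M) {x : Site d} (hx : x ≠ 0) :
    ‖mFourierCoeff hh x‖ ≤ Real.sqrt d ^ n / euclidNorm x ^ n * M := by
  obtain ⟨j, hE1, hkey⟩ := pow_mul_norm_mFourierCoeff_le_of_weakDeriv n hweak hx
  have hE0 : 0 < euclidNorm x := by linarith
  rw [div_mul_eq_mul_div, le_div_iff₀ (pow_pos hE0 n), mul_comm]
  exact hkey.trans (mul_le_mul_of_nonneg_left ((norm_mFourierCoeff_le _ _).trans (hM j))
    (by positivity))

/-- **The `o(1)` clause of Lemma 3.1 in the pure directions**: with the hypotheses of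
`norm_mFourierCoeff_le_of_weakDeriv_of_ne_zero`, `|x|ⁿ h(x) → 0` as `|x| → ∞` (the
Riemann–Lebesgue lemma for the `d` integrable functions `ĥ_{(j,…,j)}`).
[cite: LiuSlade2026, Lemma 3.1 ("Moreover, |x|^a h(x) → 0 as |x| → ∞")] [cite: LiuSlade2024, Lemma 2.3 and its proof (Riemann–Lebesgue)] -/
theorem tendsto_pow_mul_norm_mFourierCoeff_of_weakDeriv (n : ℕ) {hh : UnitAddTorus (Fin d) → ℂ}
    {w : Fin d → UnitAddTorus (Fin d) → ℂ}
    (hweak : ∀ j : Fin d, HasTorusWeakDeriv hh (List.replicate n j) (w j)) :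
    Tendsto (fun x : Site d => euclidNorm x ^ n * ‖mFourierCoeff hh x‖) cofinite (𝓝 0) := by
  have hRL : ∀ j : Fin d, Tendsto (fun x : Site d => ‖mFourierCoeff (w j) x‖) cofinite (𝓝 0) := by
    intro j
    have h := (Literature.Analysis.Fourier.tendsto_mFourierCoeff_cofinite (hweak j).2.1).norm
    rwa [norm_zero] at h
  have hsum : Tendsto (fun x : Site d => Real.sqrt d ^ n * ∑ j, ‖mFourierCoeff (w j) x‖)
      cofinite (𝓝 0) := by
    have h := (tendsto_finsetSum Finset.univ fun j _ => hRL j).const_mul (Real.sqrt d ^ n)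
    rwa [Finset.sum_const_zero, mul_zero] at h
  -- off the finite set `{0}` the bound of the previous lemma applies
  refine squeeze_zero_norm' ?_ hsum
  have hfin : Set.Finite {x : Site d | x = 0} := by
    simp only [Set.setOf_eq_eq_singleton, Set.finite_singleton]
  filter_upwards [hfin.compl_mem_cofinite] with x hx
  have hx0 : x ≠ 0 := fun h => hx (by simpa using h)
  rw [Real.norm_eq_abs, abs_of_nonneg (mul_nonneg (pow_nonneg (euclidNorm_nonneg x) n) (norm_nonneg _))]
  obtain ⟨j, -, hkey⟩ := pow_mul_norm_mFourierCoeff_le_of_weakDeriv n hweak hx0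
  refine hkey.trans (mul_le_mul_of_nonneg_left ?_ (by positivity))
  exact Finset.single_le_sum (fun i _ => norm_nonneg (mFourierCoeff (w i) x)) (Finset.mem_univ j)

/-! ## Part 5. Proof of Theorem 2.2 assuming Proposition 3.2 -/

/-- Fourier coefficients commute with scalars. [folklore] -/
theorem mFourierCoeff_const_mul (c : ℂ) (h : UnitAddTorus (Fin d) → ℂ) (x : Site d) :
    mFourierCoeff (fun t => c * h t) x = c * mFourierCoeff h x := by
  rw [Torus.mFourierCoeff_eq_integral_volume, Torus.mFourierCoeff_eq_integral_volume,
    ← integral_const_mul]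
  refine integral_congr_ae (ae_of_all _ fun t => ?_)
  simp only [smul_eq_mul]
  ring

/-- **Liu–Slade 2026, "Proof of Theorem 2.2 assuming Proposition 3.2".** The hypothesis `h32` is
the part of Proposition 3.2 that the printed proof consumes ("By (3.6), `r = 1` is permitted in
(3.8) and (3.9) for all `|α| ≤ n_d`"; Lemma 3.1 is applied in the pure directions `α = (j,…,j)`,
`|α| = n_d`): under Assumption 2.1 with `β` small and `L ≥ L₀`, `f̂_z` (`lsfHat`) is integrable
with `‖f̂_z‖₁ ≤ Cβ` ((3.8) at `α = 0`), and for every direction `j` it has a weak derivative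
`f̂_{(j,…,j)}` of order `n_d` (Liu–Slade 2024, Definition A.1, `HasTorusWeakDeriv`) with
`‖f̂_{(j,…,j)}‖₁ ≤ C(β(L^{-c} + β) + β₁)` ((3.9); `n_d ≥ 1`), the constants being independent of
`z, β₀, β₁, L`. Conclusion: the named fact `LiuSlade2026_thm22` (Theorem 2.2 with (2.8), its
`o(|x|^{-n_d})` clause, and the absolute convergence of (2.1)). Proof as printed:
`𝒢_z = λ_z S_{μ_z} + f_z` on the Fourier side ((3.4)–(3.5): `𝒢_z = ∫e^{-ik·x}/F̂_z`,
`S_{μ_z} = ∫e^{-ik·x}/Â_{μ_z}` by `fourierInverseG_soA`, both absolutely convergent by the infrared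
bounds (2.3) (`LiuSlade2026_infraredBound_holds`) and (3.15), with `μ_z ∈ [0,1]`, `λ_z ∈ (0,2]` from
(2.5)–(2.6), `exists_lsLambda_estimates`), then `|f_z(0)| ≤ ‖f̂_z‖₁ ≲ β`, Lemma 3.1 off the origin
(`norm_mFourierCoeff_le_of_weakDeriv_of_ne_zero`) for `x ≠ 0`, and its Riemann–Lebesgue clause
(`tendsto_pow_mul_norm_mFourierCoeff_of_weakDeriv`) for `f_z(x) = o(|x|^{-n_d})`.
[cite: LiuSlade2026, Theorem 2.2 and "Proof of Theorem 2.2 assuming Proposition 3.2" (§3.1), Proposition 3.2 with (3.8)–(3.9)] -/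
theorem LiuSlade2026_thm22_of_prop32
    (h32 : ∀ d : ℕ, 2 < d → ∀ ρ : ℝ, max (((d : ℝ) - 8) / 2) 0 < ρ →
      ∃ βs : ℝ, 0 < βs ∧ ∃ c : ℝ, 0 < c ∧ ∃ C : ℝ, ∃ L₀ : ℕ, ∀ L : ℕ, L₀ ≤ L →
        ∀ (z β₀ β₁ : ℝ) (Pz : Site d → ℝ), 0 ≤ β₀ → 0 ≤ β₁ → max β₀ β₁ ≤ βs →
          LSAssumptionF d L ρ β₀ β₁ z Pz →
            Integrable (lsfHat d L z Pz) ∧ (∫ t, ‖lsfHat d L z Pz t‖) ≤ C * max β₀ β₁ ∧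
            ∀ j : Fin d, ∃ w : UnitAddTorus (Fin d) → ℂ,
              HasTorusWeakDeriv (lsfHat d L z Pz) (List.replicate (lsND d ρ) j) w ∧
              (∫ t, ‖w t‖) ≤ C * (max β₀ β₁ * ((L : ℝ) ^ (-c) + max β₀ β₁) + β₁)) :
    LiuSlade2026_thm22 := by
  intro d hd ρ hρ
  have hd1 : 1 ≤ d := by omega
  have hd3 : 3 ≤ d := by omega
  have hρ0 : 0 < ρ := lt_of_le_of_lt (le_max_right _ _) hρ
  have hsd : (d : ℝ) < (d : ℝ) + 2 + ρ := by linarith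
  -- the inputs: (2.3), (2.5)–(2.6), Proposition 3.2
  obtain ⟨βs₁, hβs₁, K, hK, L₁, hIR⟩ := LiuSlade2026_infraredBound_holds d hd1 ρ hρ
  obtain ⟨Kl, hKl, hlam⟩ := exists_lsLambda_estimates d hd1 hρ0
  obtain ⟨βs₂, hβs₂, c, hc, C₂, L₂, h32'⟩ := h32 d hd ρ hρ
  refine ⟨min βs₁ (min βs₂ (1 / (2 * Kl))), lt_min hβs₁ (lt_min hβs₂ (by positivity)), c, hc,
    max C₂ (Real.sqrt d ^ lsND d ρ * C₂), max L₁ (max L₂ 1), ?_⟩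
  intro L hL z β₀ β₁ Pz hβ₀ hβ₁ hβ hA
  have hL₁ : L₁ ≤ L := le_trans (le_max_left _ _) hL
  have hL₂ : L₂ ≤ L := le_trans ((le_max_left _ _).trans (le_max_right _ _)) hL
  have hL1 : 1 ≤ L := le_trans ((le_max_right _ _).trans (le_max_right _ _)) hL
  have hL1r : (1 : ℝ) ≤ L := by exact_mod_cast hL1
  have hβ1 : max β₀ β₁ ≤ βs₁ := hβ.trans (min_le_left _ _)
  have hβ2 : max β₀ β₁ ≤ βs₂ := hβ.trans ((min_le_right _ _).trans (min_le_left _ _))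
  have hβnn : 0 ≤ max β₀ β₁ := hβ₀.trans (le_max_left _ _)
  have hKβ : Kl * max β₀ β₁ ≤ 1 / 2 := by
    have h3 : max β₀ β₁ ≤ 1 / (2 * Kl) := hβ.trans ((min_le_right _ _).trans (min_le_right _ _))
    calc Kl * max β₀ β₁ ≤ Kl * (1 / (2 * Kl)) := mul_le_mul_of_nonneg_left h3 hKl.le
      _ = 1 / 2 := by field_simp
  obtain ⟨hz1, hsymm, hbd, hF0⟩ := hA
  obtain ⟨-, -, -, -, ⟨hlampos, hlamle2, -⟩, ⟨hμ0, hμ1, -⟩⟩ :=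
    hlam L hL1 β₀ β₁ z Pz hβ₀ hβ₁ hKβ ⟨hz1, hsymm, hbd, hF0⟩
  -- abbreviations
  set F : Site d → ℝ := lsF d L z Pz with hFdef
  set lam : ℝ := lsLambda d L F with hlamdef
  set μ : ℝ := lsMu d L F with hμdef
  -- summability and continuity of `F̂_z`
  have hPabs : Summable fun x => |Pz x| := summable_abs_of_lsBound hβ₀ hbd hsd
  have hFabs : Summable fun x => |F x| := by
    have hD : Summable fun x : Site d => |z * soStep d L x| := by
      simpa only [abs_mul] using summable_abs_soStep.mul_left |z|
    refine ((summable_abs_delta0.add hD).add hPabs).of_nonneg_of_le (fun x => abs_nonneg _) fun x => ?_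
    simp only [hFdef, lsF]
    calc |delta0 x - z * soStep d L x - Pz x| ≤ |delta0 x - z * soStep d L x| + |Pz x| := abs_sub _ _
      _ ≤ |delta0 x| + |z * soStep d L x| + |Pz x| := by gcongr; exact abs_sub _ _
  have hFcont : Continuous (latticeFourier F) := continuous_latticeFourier hFabs
  -- (2.3): the infrared bound for `F̂_z`, and `Re F̂_z(0) = Σ F_z ≥ 0`
  have hF0re : (latticeFourier F 0).re = ∑' x, F x := by
    rw [latticeFourier_zero, Complex.ofReal_re]
  have hminL : ∀ t : UnitAddTorus (Fin d),
      min (∑ i, ‖t i‖ ^ 2) 1 ≤ min ((L : ℝ) ^ 2 * ∑ i, ‖t i‖ ^ 2) 1 := fun t =>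
    min_le_min_right _ (le_mul_of_one_le_left (Finset.sum_nonneg fun i _ => sq_nonneg _)
      (one_le_pow₀ hL1r))
  have hlowF : ∀ t, K * min (∑ i, ‖t i‖ ^ 2) 1 ≤ (latticeFourier F t).re := by
    intro t
    have h := hIR L hL₁ z β₀ β₁ Pz hβ₀ hβ₁ hβ1 hz1 hsymm hbd t
    have h0 : 0 ≤ (latticeFourier F 0).re := by rw [hF0re]; exact hF0
    calc K * min (∑ i, ‖t i‖ ^ 2) 1 ≤ K * min ((L : ℝ) ^ 2 * ∑ i, ‖t i‖ ^ 2) 1 :=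
          mul_le_mul_of_nonneg_left (hminL t) hK.le
      _ ≤ (latticeFourier F t).re := by linarith
  have hintF : Integrable fun t => (latticeFourier F t)⁻¹ := integrable_inv_of_infrared hd3 hFcont hK hlowF
  -- (3.15): the infrared bound for `Â_1`, hence for `Â_μ`, `μ = μ_z ∈ [0,1]`
  have hA1 : ∀ t, K * min (∑ i, ‖t i‖ ^ 2) 1 ≤ 1 - (latticeFourier (soStep d L) t).re := by
    intro t
    have hsymm0 : IsZdSymmetric (fun _ : Site d => (0 : ℝ)) := fun _ _ _ => rfl
    have hbd0 : ∀ x : Site d, |(fun _ : Site d => (0 : ℝ)) x| ≤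
        0 * delta0 x + 0 / jnorm x ^ ((d : ℝ) + 2 + ρ) := fun x => by simp
    have h := hIR L hL₁ 1 0 0 (fun _ => 0) le_rfl le_rfl (by rw [max_self]; exact hβs₁.le) le_rfl
      hsymm0 hbd0 t
    rw [← soA_eq_lsF, latticeFourier_soA, latticeFourier_zero] at h
    have hsum0 : ∑' x, soA d L 1 x = 0 := by
      have := (hasSum_delta0 (d := d)).sub ((hasSum_soStep hd1 hL1).mul_left (1 : ℝ))
      rw [mul_one, sub_self] at this
      exact this.tsum_eq
    rw [hsum0] at h
    simp only [Complex.ofReal_zero, Complex.zero_re, sub_zero, Complex.sub_re, Complex.one_re,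
      Complex.ofReal_one, one_mul] at h
    exact (mul_le_mul_of_nonneg_left (hminL t) hK.le).trans h
  have hlowA : ∀ t, K / 2 * min (∑ i, ‖t i‖ ^ 2) 1 ≤ (latticeFourier (soA d L μ) t).re := by
    intro t
    have h1 := hA1 t
    have h2 := re_latticeFourier_soA_ge hd1 hL1 hμ0 hμ1 t
    linarith
  have hintA : Integrable fun t => (latticeFourier (soA d L μ) t)⁻¹ :=
    integrable_inv_of_infrared hd3 (continuous_latticeFourier (summable_abs_soA μ)) (half_pos hK) hlowA
  -- Proposition 3.2
  obtain ⟨hfint, hf1, hderiv⟩ := h32' L hL₂ z β₀ β₁ Pz hβ₀ hβ₁ hβ2 ⟨hz1, hsymm, hbd, hF0⟩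
  choose w hweak hwM using hderiv
  -- (3.4)–(3.5): `𝒢_z(x) - λ_z S_{μ_z}(x) = f_z(x) = Re 𝓕f̂_z(x)`
  have hident : ∀ x : Site d,
      fourierInverseG F x - lam * soGreen d L μ x = (mFourierCoeff (lsfHat d L z Pz) x).re := by
    intro x
    have hf : lsfHat d L z Pz = fun t => (latticeFourier F t)⁻¹ -
        (lam : ℂ) * (latticeFourier (soA d L μ) t)⁻¹ := rfl
    rw [hf, mFourierCoeff_sub hintF (hintA.const_mul _), mFourierCoeff_const_mul, Complex.sub_re,
      Complex.re_ofReal_mul, ← fourierInverseG_soA hd3 hL1 hμ0 hμ1 x]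
    rfl
  have hbound : ∀ x : Site d,
      |fourierInverseG F x - lam * soGreen d L μ x| ≤ ‖mFourierCoeff (lsfHat d L z Pz) x‖ := fun x => by
    rw [hident x]; exact Complex.abs_re_le_norm _
  -- the size `M = C₂(β(L^{-c} + β) + β₁)` of the top-order derivatives
  set M : ℝ := C₂ * (max β₀ β₁ * ((L : ℝ) ^ (-c) + max β₀ β₁) + β₁) with hMdef
  have herr_nn : 0 ≤ max β₀ β₁ * ((L : ℝ) ^ (-c) + max β₀ β₁) + β₁ :=
    add_nonneg (mul_nonneg hβnn (add_nonneg (Real.rpow_nonneg (Nat.cast_nonneg L) _) hβnn)) hβ₁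
  refine ⟨hintF, ?_, ?_, ?_⟩
  · -- `x = 0`: `|f_z(0)| ≤ ‖f̂_z‖₁ ≤ C₂ β`
    calc |fourierInverseG F 0 - lam * soGreen d L μ 0| ≤ ‖mFourierCoeff (lsfHat d L z Pz) 0‖ := hbound 0
      _ ≤ ∫ t, ‖lsfHat d L z Pz t‖ := norm_mFourierCoeff_le _ _
      _ ≤ C₂ * max β₀ β₁ := hf1
      _ ≤ max C₂ (Real.sqrt d ^ lsND d ρ * C₂) * max β₀ β₁ :=
          mul_le_mul_of_nonneg_right (le_max_left _ _) hβnn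
  · -- `x ≠ 0`: Lemma 3.1 off the origin with the top-order bound (3.9)
    intro x hx
    have hE0 : 0 < euclidNorm x := lt_of_lt_of_le one_pos (one_le_euclidNorm_of_ne_zero hx)
    have h := norm_mFourierCoeff_le_of_weakDeriv_of_ne_zero (lsND d ρ) (M := M) hweak hwM hx
    calc |fourierInverseG F x - lam * soGreen d L μ x| ≤ ‖mFourierCoeff (lsfHat d L z Pz) x‖ := hbound x
      _ ≤ Real.sqrt d ^ lsND d ρ / euclidNorm x ^ lsND d ρ * M := h
      _ = Real.sqrt d ^ lsND d ρ * C₂ * (max β₀ β₁ * ((L : ℝ) ^ (-c) + max β₀ β₁) + β₁) /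
            euclidNorm x ^ lsND d ρ := by rw [hMdef]; ring
      _ ≤ max C₂ (Real.sqrt d ^ lsND d ρ * C₂) * (max β₀ β₁ * ((L : ℝ) ^ (-c) + max β₀ β₁) + β₁) /
            euclidNorm x ^ lsND d ρ := by
          gcongr
          exact le_max_right _ _
  · -- `f_z(x) = o(|x|^{-n_d})`: the Riemann–Lebesgue clause of Lemma 3.1
    refine squeeze_zero_norm (fun x => ?_) (tendsto_pow_mul_norm_mFourierCoeff_of_weakDeriv _ hweak)
    rw [norm_mul, Real.norm_eq_abs, Real.norm_eq_abs,
      abs_of_nonneg (pow_nonneg (euclidNorm_nonneg x) _), mul_comm]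
    exact mul_le_mul_of_nonneg_left (hbound x) (pow_nonneg (euclidNorm_nonneg x) _)

end Literature.Barriers.CriticalPhenomena.SpreadOutIsing

end
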